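import Literature.MathematicalPhysics.QuantumFieldTheory.Balaban1983to89.B8Prop5JoinSectELocal
import Literature.MathematicalPhysics.QuantumFieldTheory.Balaban1983to89.B8Prop5SocketDatum
import Literature.MathematicalPhysics.QuantumFieldTheory.Balaban1983to89.B8LeafModelZdOfHFP
import Literature.MathematicalPhysics.QuantumFieldTheory.Balaban1983to89.B8Prop5Reality

/-!
# `Balaban1983to89.B8SockHFPAssembly` — [Balaban1985RegularSpaces] Prop. 5 p. 94 with Thm 4 p. 88: THE TRANCHE-2 ASSEMBLY of the
# Proposition-5 fixed-point socket `B8LeafModelZdOfHFP.SockHFP` AT ONE DATUM — the Sect. D/E JOIN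
# `B8Prop5JoinSectELocal.hFP_kLevel_of_sectE_local'` INSTANTIATED on the inductive datum of Theorem 4 through the datum dictionary
# `B8Prop5SocketDatum` §1–§7, with the [4] letters, the b9 socket at level `m` and the scalar windows DISPLAYED

statement-level skeleton of published theorems with citation tags; proofs where landed; nothing here is a claim about the
Yang–Mills mass gap

PDF held: `paper:balaban1985-cmp99-regular-spaces-gauge-fixing` (journal page = PDF page + 74); p. 88 (Thm 4, (1.67)–(1.69)), p. 89
(«we take Λ_{k−1} ∪ B(Λ_k) as Λ_{k−1}»), pp. 92–94 ((1.92)–(1.106), Prop. 5 (1.106)–(1.109)), pp. 95–97 (Sect. E).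

WHY THIS FILE (cell `pub-ymgap`, R134 acceleration seat `pub-ymgap-dag-n05-d`, strategy s2 of DAG node N05 = [B8]; dag-lead REBALANCE №49:
(α)(β) = `pub-ymgap-dag-n05-a` g6's `B8Prop5SocketDatum`, (γ) windows = `pub-ymgap-dag-n19-b` g4's `B8SockHFPOfLetters` §1, (δ)+assembly =
tranche 2, this file; count-neutral).  The knit `B8LeafKnitZd3B9All.b8LeafRS_zd3_univ_b9all` carries the Proposition-5 socket `SockHFP` (the
fixed point of (1.106)/(1.107) in plain currency for every level-`m` datum of Theorem 4's induction) as a HYPOTHESIS per member.  Its provider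
is the JOIN `hFP_kLevel_of_sectE_local'` (≈ 75 binders: [4]'s letters `G′ = g, Δ, Q′ = q, Q′ᵀ = qs, 𝔄 = Aw, C = c, H′` with their laws,
the datum's tower-local regime AT `u₁`, the source `D*A`, the scalar windows).  THIS FILE runs the JOIN at `k := m + 1` levels for the FULL
structure `Λs (m+1)`, bond classes `Eb j := {b ∣ SideTouches (Ω j) b}`, exponent `B := iηA′` (the MASKED datum of `exists_masked_datum`:
globally Hermitian, `= A` on the sides touching `Ω_j`, `j ≤ m`), `αP := α₀`, `α₄ := 8B₀′c⋆` (`B₀′` = the SOCKET's constant, `c⋆ =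
5dLB₀(α₀ + α₁)`), free `cB ≥ L·c⋆`, `cA ≥ L·c⋆`, `cDA ≥ d·L²·c⋆`, feeding EVERY datum binder BY NAME: `h33_of_inAk`, `hP_of_datum`,
`h69_of_datum`, `hA_of_datum` (§7), `grad_bound_of_datum` ((1.69) from (1.67)–(1.68) by Prop. 3 at level `m`, modulo `SockB9P3 … m …`) +
`bd2_covDivB_of_grad` (§3–§4), `restr129_succ_of_truncation` (index law №8, §5), `sideTouches_pair_of_mem`/`sideTouches_of_tower_bond` (§6),
`inAx_congr_of_towers` (§1); then transports the JOIN's multiplier clause from `A′` back to the socket's `A` (they agree on `Ω₀`).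

WHAT THIS FILE PROVES (kernel, 0 sorry, theorems only):
* §0 `isSelfAdjoint_covDivB` (the JOIN's `hDAsa`), `covDivB_congr_at`, `frakF3_congr_at` (locality in the exponent), `mgauge_one_eq`,
  **`inAx_mgauge_expCfg_of_datum`** (the JOIN's `hAx` from the socket's (1.34) at the truncation `m + 1`);
* §1 **`sockHFP_body_of_join`** — THE ∃λ-BODY OF `SockHFP` AT ONE LEVEL-`m` DATUM (`1 ≤ m < k`) from: the socket's antecedents VERBATIM,
  the member's geometry (`Ω` antitone, `hbox`/`hclass`, towers of `Λs (m+1)` inside `Ω_j`, index law №8 at `m`), the b9 socket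
  `SockB9P3 … m …` below whose threshold `α₀, c⋆` lie, four Prop-3 windows at `(α₀, α₂ := c⋆)`, the [4] LETTERS at `(m + 1, U₀)` DISPLAYED
  exactly as the JOIN's, and the JOIN's scalar windows DISPLAYED one-for-one (so that n19-b's `joinWindows_of_guard` feeds them positionally);
* §2 **`sockHFP₀_body_of_join`** — the same for the BASE datum `u₁ = 1`, `U₁ = U′` (p. 89): the ∃λ-body of `SockHFP₀` from the JOIN at ONE
  level (`restr129_one`, `grad_bound_trivial` ⇒ `cDA ≥ 2·d·L²·c⋆`; no Proposition 3, no b9 socket at level `0`).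

HONEST SCOPE.  Plumbing by name over landed modules; nothing of Proposition 5's contraction, of [4]'s letters (hypotheses), of [4] Thm 3.3
(the b9 socket is a hypothesis) or of Sect. E is proved here beyond composition; windows are displayed, not discharged.  Count-neutral; N05 NOT
discharged; one finite T⁴ programme at fixed ε; nothing continuum / ℝ⁴ / OS / mass-gap / Clay.  Unit `pub-ymgap-dag-n05-d` (g0), 2026-08-26.
-/

noncomputable section

open NormedSpace
open scoped BigOperators

namespace Literature.MathematicalPhysics.QuantumFieldTheory.Balaban1983to89.B8SockHFPAssembly

open Complex (I)
open B7Prop1Explicit B7Prop2Explicit B7Prop1Local B7Eq92Concrete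
open B7Prop2Explicit (C0 c2')
open B7Prop3Flat (c3)
open B7Prop10General (C6 C4G)
open B7Prop9Flat (C5')
open B7Eq78Linearization (conjR zdBlocking QprimeIter)
open B8Ineq132 (covDerivFwd covDeriv InAk)
open B8Eq119TwistedAxial (Restr129 InAx bgT)
open B8Eq184Proof (gaugeExp cfgExp)
open B8Eq182Proof (gAd)
open B8Eq188Proof (frakF3)
open B8Lemma1NonAbelian (mulCfg)
open B8Eq140Level (SideTouches sideTouches_mono)
open B8Eq146AExpansion (iEta expCfg)
open B8Ineq130 (tlo thi)
open B8Thm2LogB (blockTop)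
open B8Eq138LandauZd (IsLandau138W covDivB covLap QT)
open B8Ineq125Concrete (C2p)
open B8Eq1117Concrete (XSpace)
open B8Prop3GaugeFixedKLevel (expCfg_iEta_eq_cfgExp)
open B8Eq155JBound (expCfg_iEta_mem_unitaryUnits)
open B8LeafModelZd3 (SockB9P3)
open B8Prop5ContractionKLevel (Bd2 Mc Kc)
open B8LambdaSpaceKLevel (wt)
open B8Prop5Reality (isSelfAdjoint_covDeriv)
open B8Prop5SocketDatum (inAx_congr_of_towers exists_masked_datum grad_bound_of_datum grad_bound_trivial bd2_covDivB_of_grad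
  restr129_succ_of_truncation sideTouches_pair_of_mem sideTouches_of_tower_bond h33_of_inAk hP_of_datum h69_of_datum hA_of_datum)
open B8Prop5JoinSectELocal (hFP_kLevel_of_sectE_local')
open QuantumLattice (blockSites)

-- `Site` alone could resolve to the torus sites of `Setup.lean`; re-export the `ℤ^d` sites of `B7Prop1Explicit`.
export B7Prop1Explicit (Site)

variable {d : ℕ}

/-! ## §0 Small bookkeeping: `D*A` Hermitian; locality of `D*A` and `𝔉₃` in the exponent; `U^{1} = U`; the JOIN's `hAx` from the datum -/

section Bookkeeping

variable {𝔸 : Type*} [CStarAlgebra 𝔸]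

/-- **`D*A = Σ_μ D^{η*}_{U₀,μ}A_μ` is Hermitian** for a Hermitian `A` at a UNITARY background (each summand by `B8Prop5Reality.isSelfAdjoint_covDeriv`) —
the JOIN's binder `hDAsa`. [cite: Balaban1985RegularSpaces, (1.1)–(1.2) p.76, (1.99) p.93] -/
theorem isSelfAdjoint_covDivB {η : ℝ} {U₀ : Site d → Fin d → 𝔸ˣ} (hU₀ : ∀ x κ, U₀ x κ ∈ unitaryUnits 𝔸) {A : Site d → Fin d → 𝔸}
    (hA : ∀ x μ, IsSelfAdjoint (A x μ)) (x : Site d) : IsSelfAdjoint (covDivB η U₀ A x) := by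
  rw [IsSelfAdjoint, covDivB, star_sum]
  exact Finset.sum_congr rfl fun μ _ => (isSelfAdjoint_covDeriv (η := η) hU₀ (fun z => hA z μ) μ x).star_eq

/-- **Locality of `D*A` in `A`**: `(D*A)(x)` reads `A` on the `2d` bonds `⟨x, x + e_μ⟩`, `⟨x − e_μ, x⟩` only.
[cite: Balaban1985RegularSpaces, (1.1)–(1.2) p.76; Balaban1985BackgroundPropagators, (3.23) p.394] -/
theorem covDivB_congr_at (η : ℝ) (U₀ : Site d → Fin d → 𝔸ˣ) {A A' : Site d → Fin d → 𝔸} {x : Site d}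
    (h₁ : ∀ μ : Fin d, A' x μ = A x μ) (h₂ : ∀ μ : Fin d, A' (x - e μ) μ = A (x - e μ) μ) :
    covDivB η U₀ A' x = covDivB η U₀ A x := by
  simp only [covDivB, covDeriv, h₁, h₂]

/-- **Locality of `𝔉₃,μ(λ, A)(x)` ((1.88)–(1.89)) in `A`**: it reads `A_μ(x)` and `A_μ(x − e_μ)` only. [cite: Balaban1985RegularSpaces, (1.88)–(1.89) p.91] -/
theorem frakF3_congr_at (η : ℝ) (U₀ : Site d → Fin d → 𝔸ˣ) (lam : Site d → 𝔸) {A A' : Site d → Fin d → 𝔸} {x : Site d} {μ : Fin d}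
    (h₁ : A' x μ = A x μ) (h₂ : A' (x - e μ) μ = A (x - e μ) μ) : frakF3 η U₀ lam A' x μ = frakF3 η U₀ lam A x μ := by
  simp only [frakF3, h₁, h₂]

/-- `U^{1} = U` for the moving-frame action (1.17) (= [3] (55)): the base datum `u₁ = 1`, `U₁ = U′` of Theorem 4 (p. 89).
[cite: Balaban1985RegularSpaces, (1.17) p.78, p.89; Balaban1985Averaging, (55) p.27] -/
theorem mgauge_one_eq {G : Type*} [Group G] (V₀ W : Site d → Fin d → G) : mgauge V₀ 1 W = W := by
  funext x κ
  simp [mgauge_apply]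

/-- **The JOIN's `hAx` from the datum**: the block axial gauge (1.19)/(1.34) of `U′U₀` relative to `U₀` at the truncation `m + 1` transfers to
`(e^{iηA′})^{u₁}·U₀` — the two agree on every bond of every tower `Bʲ(y) ⊂ Ω_j`, `y ∈ Λ_j`, `j ≤ m + 1` (`U′ = U₁^{u₁}`, `U₁ = e^{iηA′}` on the sides of
the plaquettes touching `Ω_{j′}`, `j′ ≤ m`, and `Ω_{m+1} ⊂ Ω_m`), and `Ax` reads the towers only (`B8Prop5SocketDatum.inAx_congr_of_towers`).
[cite: Balaban1985RegularSpaces, (1.19)–(1.20) p.79, (1.34) p.82, (1.69) p.88] -/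
theorem inAx_mgauge_expCfg_of_datum (hd2 : 2 ≤ d) {L : ℕ} (hL : 1 ≤ L) {η : ℝ} {Ω : ℕ → Set (Site d)} (hΩ : ∀ j, Ω (j + 1) ⊆ Ω j)
    {m : ℕ} {Λ : ℕ → Set (Site d)} (htower : ∀ j, j ≤ m + 1 → ∀ y ∈ Λ j, ∀ x, InBox (tlo L y j) (thi L y j) x → x ∈ Ω j)
    {U₀ U' U₁ : Site d → Fin d → 𝔸ˣ} {u₁ : Site d → 𝔸ˣ} {A' : Site d → Fin d → 𝔸} (hW : mgauge U₀ u₁ U₁ = U')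
    (hWA : ∀ j, j ≤ m → ∀ (y : Site d) (τ : Fin d), SideTouches (Ω j) y τ → U₁ y τ = cfgExp η A' y τ)
    (hAx : InAx L (m + 1) Λ U₀ (mulCfg U' U₀)) : InAx L (m + 1) Λ U₀ (mgauge U₀ u₁ (expCfg (iEta η A')) * U₀) := by
  refine (inAx_congr_of_towers hL (m + 1) Λ U₀ (mulCfg U' U₀) _ fun j _ hj y hy x κ hx _ => ?_).1 hAx
  -- the bond `⟨x, x + e_κ⟩` starts in the tower `⊂ Ω_j`: a side touching `Ω_j` (`j ≤ m`) or `Ω_m ⊃ Ω_{m+1}` (`j = m + 1`)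
  have hs : ∃ j', j' ≤ m ∧ SideTouches (Ω j') x κ := by
    have hs0 : SideTouches (Ω j) x κ := sideTouches_of_tower_bond hd2 htower hj hy x κ hx
    rcases Nat.lt_or_ge j (m + 1) with hjm | hjm
    · exact ⟨j, by omega, hs0⟩
    · obtain rfl : j = m + 1 := le_antisymm hj hjm
      exact ⟨m, le_rfl, sideTouches_mono (hΩ m) hs0⟩
  obtain ⟨j', hj', hs'⟩ := hs
  show U' x κ * U₀ x κ = mgauge U₀ u₁ (expCfg (iEta η A')) x κ * U₀ x κ
  rw [← hW, mgauge_apply, mgauge_apply, hWA j' hj' x κ hs', expCfg_iEta_eq_cfgExp]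

end Bookkeeping

/-! ## §1 THE TRANCHE-2 ASSEMBLY AT ONE LEVEL-`m` DATUM: the ∃λ-body of `SockHFP` from the JOIN + the datum dictionary -/

section Body

variable {𝔸 : Type*} [CStarAlgebra 𝔸] [Nontrivial 𝔸]

/-- **PROPOSITION 5'S FIXED POINT FOR THE LEVEL-`m` DATUM OF THEOREM 4, IN THE SOCKET'S CURRENCY — the ∃λ-body of `B8LeafModelZdOfHFP.SockHFP`
assembled from the Sect. D/E JOIN `B8Prop5JoinSectELocal.hFP_kLevel_of_sectE_local'`.**  SETTING = the antecedents of `SockHFP` at one member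
(`K = k` levels, spacing `η`, antitone regions `Ω`, structures `Λs m′`, bond classes `Λb m′` with `hbox`/`hclass`) and one datum: `U₀, U′`
unitary with (1.33)/(1.34) (`InAk`, `InAx` at every truncation) and the box-closeness (1.35)/(1.66) `≤ α₁`; the level-`m` datum (`1 ≤ m < k`)
`u₁` unitary, `U₁^{u₁} = U′`, (1.29) `Restr129 L m (Λs m) U₀ u₁` (TRUNCATED structure), the Landau condition of record for `U₁`, and
`U₁ = e^{iηA}`, `A` Hermitian, `|A| ≤ c⋆(Lʲη)⁻¹` on the sides of the plaquettes touching `Ω_j`, `j ≤ m` ((1.67)–(1.68), `c⋆ = 5dLB₀(α₀ + α₁)`).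
MEMBER GEOMETRY displayed: towers of `Λs (m+1)` inside `Ω_j` (p. 77 «Bʲ(y) ⊂ Ω_j») and INDEX LAW №8 at `m` (`Λs m` is the truncation of
`Λs (m+1)`, p. 89 «we take Λ_{k−1} ∪ B(Λ_k) as Λ_{k−1}»).  IN-EDGE b9: `SockB9P3 … m …` ([4] Thm 3.3 in Prop. 3's frame at level `m`) with
`α₀, c⋆` below its threshold.  THE [4] LETTERS at `(m + 1, U₀)` — `g Δ q qs Aw c H′` with the projection laws, the readings `hΔ hqs hq hQH`,
(1.92) `hH0 hH1 hH2`, Dirichlet range and reality `hHsupp hHequiv hGsupp hGreal hRreal`, (1.101) `hG`, (1.98) `hRbd` — DISPLAYED exactly as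
the JOIN's with `k := m + 1`, `Λs := Λs (m+1)`, `Eb j := {b ∣ SideTouches (Ω j) b}`.  WINDOWS displayed: four of Prop. 3's at
`(α₀, α₂ := c⋆)` (`hside h61 hC₂ hsmall₁`; the others follow from the JOIN's) and the JOIN's scalar windows ONE-FOR-ONE at `αP := α₀`,
`α₄ := 8B₀′c⋆`, `cB ≥ L·c⋆`, `cA ≥ L·c⋆`, `cDA ≥ d·L²·c⋆`.  CONCLUSION — VERBATIM the ∃λ-body of `SockHFP` at this datum: `λ` Hermitian,
`= 0` off `Ω₀` ((1.109)), (1.108) at `8B₀′c⋆` on the sides touching `Ω_j`, `j ≤ m + 1`, the multiplier form of the Landau equation at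
`m + 1` levels, and (1.29) at `m + 1` levels for `u₁·e^{iλ}`.  PROOF: `exists_masked_datum` → the datum binders BY NAME (`B8Prop5SocketDatum`
§1, §3–§7) → the JOIN (n19-b, BY NAME) at `A′` → transport `A′ ↦ A` on `Ω₀` (`covDivB_congr_at`, `frakF3_congr_at`).
[cite: Balaban1985RegularSpaces, Prop. 5 (1.106)–(1.109) p.94, Thm 4 p.88, (1.67)–(1.69) p.88, p.89, (1.92)–(1.103) pp.92–93; Balaban1985BackgroundPropagators, Thm 3.3 p.398] -/
theorem sockHFP_body_of_join (hd2 : 2 ≤ d) {L : ℕ} (hL : 2 ≤ L) {η : ℝ} (hη : 0 < η) {k : ℕ}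
    -- the member's geometry
    {Ω : ℕ → Set (Site d)} (hΩ : ∀ j, Ω (j + 1) ⊆ Ω j) {Λs : ℕ → ℕ → Set (Site d)} {Λb : ℕ → ℕ → Set (Site d × Fin d)}
    (hbox : ∀ m, m ≤ k → ∀ j, j ≤ m → ∀ c ∈ Λb m j, ∀ x, InBox (loK L j c.1) (bondHiK L j c.1 c.2) x → x ∈ Ω j)
    (hclass : ∀ m, m ≤ k → ∀ j, j ≤ m → ∀ c ∈ Λb m j,
      (c.1 ∈ Λs m j ∧ c.1 + e c.2 ∈ Λs m j) ∨
      (∃ j', j = j' + 1 ∧ (∀ x, (L : ℤ) • c.1 ≤ x → x ≤ (L : ℤ) • c.1 + blockTop L → x ∈ Λs m j') ∧ c.1 + e c.2 ∈ Λs m j) ∨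
      (∃ j', j = j' + 1 ∧ c.1 ∈ Λs m j ∧ (∀ x, (L : ℤ) • (c.1 + e c.2) ≤ x → x ≤ (L : ℤ) • (c.1 + e c.2) + blockTop L → x ∈ Λs m j')))
    {m : ℕ} (hm1 : 1 ≤ m) (hmk : m < k)
    (htower : ∀ j, j ≤ m + 1 → ∀ y ∈ Λs (m + 1) j, ∀ x, InBox (tlo L y j) (thi L y j) x → x ∈ Ω j)
    (hlt : ∀ j, j < m → Λs m j = Λs (m + 1) j)
    (htop : ∀ x, x ∈ Λs m m ↔ x ∈ Λs (m + 1) m ∨ ∃ y ∈ Λs (m + 1) (m + 1), x ∈ blockSites L y)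
    -- the socket's antecedents: constants, (1.33), (1.34), (1.35)/(1.66)
    {α₀ α₁ B₀ B₀' cs α₄ : ℝ} (hα₀ : 0 < α₀) (hα₁ : 0 < α₁) (hB₀ : 0 < B₀) (hB₀' : 0 < B₀')
    (hcs : cs = 5 * (d : ℝ) * L * B₀ * (α₀ + α₁)) (hα₄ : α₄ = 8 * B₀' * (5 * (d : ℝ) * L * B₀) * (α₀ + α₁))
    {U₀ U' : Site d → Fin d → 𝔸ˣ} (hU₀ : ∀ x κ, U₀ x κ ∈ unitaryUnits 𝔸) (hU' : ∀ x κ, U' x κ ∈ unitaryUnits 𝔸)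
    (h33 : InAk L k η α₀ Ω U₀) (h34 : InAk L k η α₀ Ω (mulCfg U' U₀)) (hAx : ∀ m', m' ≤ k → InAx L m' (Λs m') U₀ (mulCfg U' U₀))
    (h135 : ∀ j, j ≤ k → ∀ (z : Site d) (μ : Fin d), (∀ x, InBox (loK L j z) (bondHiK L j z μ) x → x ∈ Ω j) →
      ‖(avgIter L (mulCfg U' U₀) j z μ : 𝔸) - (avgIter L U₀ j z μ : 𝔸)‖ ≤ α₁)
    -- the datum at level `m`
    {u₁ : Site d → 𝔸ˣ} {U₁ : Site d → Fin d → 𝔸ˣ} {A : Site d → Fin d → 𝔸}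
    (hu₁ : ∀ x, u₁ x ∈ unitaryUnits 𝔸) (hW : mgauge U₀ u₁ U₁ = U') (h129 : Restr129 L m (Λs m) U₀ u₁)
    (hLan : IsLandau138W L m η (Ω 0) (Λs m) U₀ U₁)
    (hdat : ∀ j, j ≤ m → ∀ b ∈ {b : Site d × Fin d | SideTouches (Ω j) b.1 b.2},
      U₁ b.1 b.2 = cfgExp η A b.1 b.2 ∧ IsSelfAdjoint (A b.1 b.2) ∧ ‖A b.1 b.2‖ ≤ cs * ((L : ℝ) ^ j * η)⁻¹)
    -- the b9 socket in Proposition 3's frame AT LEVEL `m`, and its threshold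
    {B₀β cB9 β : ℝ} {len : Site d → ℝ} (SB9 : SockB9P3 (𝔸 := 𝔸) L B₀ B₀β cB9 β len η m Ω Λs Λb)
    (hα₀9 : α₀ ≤ cB9) (hcs9 : cs ≤ cB9)
    -- Proposition 3's windows at `(α₀, α₂ := c⋆)` not implied by the JOIN's
    {C₂ : ℝ} (hside : 36 * d * B₀ * cs ≤ 1 / 2)
    (hC₂ : 8 * (131072 * ((d : ℝ) + 1) ^ 2) * Real.exp (4 * (800 * ((d : ℝ) + 1) ^ 2 * ((d : ℝ) + 4)) * α₀) ≤ C₂)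
    (h61 : 2 * cs ^ 2 + 20 * d * α₀ * cs + 2 * C₂ * cs ^ 2 ≤ α₀ + α₁) (hsmall₁ : (d : ℝ) * L * α₁ ≤ 1 / 8)
    -- the [4] LETTERS at `(m + 1, U₀)`, displayed as the JOIN reads them
    (g Δ : (Site d → 𝔸) →ₗ[ℂ] (Site d → 𝔸)) (q : (Site d → 𝔸) →ₗ[ℂ] (ℕ → Site d → 𝔸)) (qs : (ℕ → Site d → 𝔸) →ₗ[ℂ] (Site d → 𝔸))
    (Aw c : (ℕ → Site d → 𝔸) →ₗ[ℂ] (ℕ → Site d → 𝔸))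
    (g_left : ∀ x, g (Δ x + qs (Aw (q x))) = x) (g_right : ∀ x, Δ (g x) + qs (Aw (q (g x))) = x)
    (c_right : ∀ φ, q (g (g (qs (c φ)))) = φ)
    (hΔ : ∀ (f : Site d → 𝔸), ∀ x ∈ Ω 0, Δ f x = covLap η U₀ ((Ω 0).indicator f) x)
    (hqs : ∀ (μ : ℕ → Site d → 𝔸), ∀ x ∈ Ω 0, qs μ x = QT L (m + 1) (Λs (m + 1)) U₀ μ x)
    (hq : ∀ (f : Site d → 𝔸) (j : ℕ), j ≤ m + 1 → ∀ y ∈ Λs (m + 1) j, q f j y = QprimeIter (zdBlocking d L) (bgT L U₀) j f y)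
    (H' : XSpace d (m + 1) 𝔸 →ₗ[ℂ] (Site d → 𝔸)) {B₀'H B₂' BG BR : ℝ} (hB₀'H : 0 < B₀'H) (hB₂' : 0 ≤ B₂') (hBG : 0 ≤ BG) (hBR : 0 ≤ BR)
    (hH0 : ∀ (X : XSpace d (m + 1) 𝔸) (x : Site d), ‖H' X x‖ ≤ B₀'H * ‖X‖)
    (hH1 : ∀ j, j ≤ m + 1 → ∀ (X : XSpace d (m + 1) 𝔸), ∀ p ∈ {b : Site d × Fin d | SideTouches (Ω j) b.1 b.2},
      wt L η j * ‖covDerivFwd η U₀ p.2 (H' X) p.1‖ ≤ B₀'H * ‖X‖)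
    (hH2 : ∀ X : XSpace d (m + 1) 𝔸, Bd2 L η (m + 1) Ω (covLap η U₀ (H' X)) (B₂' * ‖X‖))
    (hHsupp : ∀ (X : XSpace d (m + 1) 𝔸) (x : Site d), x ∉ Ω 0 → H' X x = 0)
    (hHequiv : ∀ X Y : XSpace d (m + 1) 𝔸, (∀ p, Y p = -star (X p)) → ∀ x, H' Y x = -star (H' X x))
    (hQH : ∀ (Y : XSpace d (m + 1) 𝔸) (j : ℕ) (hj : j ≤ m + 1) (y : Site d), y ∈ Λs (m + 1) j →
      QprimeIter (zdBlocking d L) (bgT L U₀) j (H' Y) y = Y (⟨j, Nat.lt_succ_of_le hj⟩, y))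
    (hG : ∀ (f : Site d → 𝔸) (r : ℝ), 0 ≤ r → Bd2 L η (m + 1) Ω f r →
      (∀ x, ‖g f x‖ ≤ BG * r) ∧ ∀ j, j ≤ m + 1 → ∀ p ∈ {b : Site d × Fin d | SideTouches (Ω j) b.1 b.2},
        wt L η j * ‖covDerivFwd η U₀ p.2 (g f) p.1‖ ≤ BG * r)
    (hGsupp : ∀ (f : Site d → 𝔸) (x : Site d), x ∉ Ω 0 → g f x = 0)
    (hGreal : ∀ f : Site d → 𝔸, (∀ j, j ≤ m + 1 → ∀ x ∈ Ω j, IsSelfAdjoint (f x)) → ∀ x, IsSelfAdjoint (g f x))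
    (hRbd : ∀ (f : Site d → 𝔸) (r : ℝ), 0 ≤ r → Bd2 L η (m + 1) Ω f r → Bd2 L η (m + 1) Ω (f - g (qs (c (q (g f))))) (BR * r))
    (hRreal : ∀ f : Site d → 𝔸, (∀ j, j ≤ m + 1 → ∀ x ∈ Ω j, IsSelfAdjoint (f x)) →
      ∀ j, j ≤ m + 1 → ∀ x ∈ Ω j, IsSelfAdjoint ((f - g (qs (c (q (g f))))) x))
    -- the JOIN's scalar windows, one-for-one (`αP := α₀`, `α₄ := 8B₀′c⋆`; `cB cA cDA` free above their datum values)
    {cB cA cDA : ℝ} (hcBlo : L * cs ≤ cB) (hcAlo : L * cs ≤ cA) (hcDAlo : (d : ℝ) * (L : ℝ) ^ 2 * cs ≤ cDA)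
    (hα3 : C0 d * α₀ ≤ 1 / 3) (hα4 : 4 * α₀ ≤ c2' d L)
    (hsmall : Real.exp (4 * (800 * ((d : ℝ) + 1) ^ 2 * ((d : ℝ) + 4)) * α₀) * (1 + 8 * (131072 * ((d : ℝ) + 1) ^ 2) * cB) ≤ 2)
    (hc₃ : 2 * cB ≤ c3 d L) (hsc : 2048 * (d : ℝ) * cB ≤ 1) (hα₃' : 40 * d * cB ≤ 1 / 200)
    (hs₁ : 200 * C6 d * (2 * α₄) ≤ 1) (hs₂ : 12000 * ((d : ℝ) + 1) * L * (2 * α₄) ≤ 1)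
    (hs₃ : C4G d L * (α₀ + 40 * d * cB + 4 * (2 * α₄)) ≤ 1)
    (hs₄ : 1024 * ((d : ℝ) + 1) * ((d : ℝ) + 4) * L ^ 2 * α₀ ≤ 1) (hs₅ : 32 * ((d : ℝ) + 1) ^ 2 * C6 d * L ^ 2 * α₀ ≤ 1)
    (hs₆ : 16 * d * C5' d * C6 d * (L : ℝ) ^ 2 * α₀ ≤ 1) (hs₇ : 8 * d * C6 d * L * α₀ ≤ 1)
    (hsm : 40 * d * cB + α₄ ≤ 1 / (4 * B₀'H * (2 * C2p d))) (hprod8 : 2 * C6 d * (40 * d * cB + 4 * α₄) ≤ 1 / 8)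
    {hE hE₂ lE lE₂ : ℝ} (hE_def : hE = B₀'H * (C2p d * (40 * d * cB + α₄) * α₄)) (hE₂_def : hE₂ = B₂' * (C2p d * (40 * d * cB + α₄) * α₄))
    (lE_def : lE = B₀'H * (4 * C2p d * (40 * d * cB + 2 * α₄))) (lE₂_def : lE₂ = B₂' * (4 * C2p d * (40 * d * cB + 2 * α₄)))
    (hcA' : cA ≤ 1 / 13) (ha₁' : α₄ / 4 + hE ≤ 1 / 24) (hb₁' : α₄ / 4 + hE ≤ 1 / 140) (hθ : 10 * (α₄ / 4 + hE) * BR ≤ 1 / 2)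
    (h103 : BG * Mc d BR (α₄ / 4 + hE) cA hE₂ cDA ≤ α₄ / 4)
    (h106 : BG * Kc d BR (α₄ / 4 + hE) cA hE₂ cDA lE₂ (1 + lE) (1 + lE) ≤ 1 / 2) :
    ∃ lam : Site d → 𝔸, (∀ x, IsSelfAdjoint (lam x)) ∧ (∀ x, x ∉ Ω 0 → lam x = 0) ∧
      (∀ j, j ≤ m + 1 → ∀ b ∈ {b : Site d × Fin d | SideTouches (Ω j) b.1 b.2},
        ‖lam b.1‖ ≤ α₄ ∧ ((L : ℝ) ^ j * η) * ‖covDerivFwd η U₀ b.2 lam b.1‖ ≤ α₄) ∧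
      (∃ μ : ℕ → Site d → 𝔸, ∀ x ∈ Ω 0,
        covLap η U₀ ((Ω 0).indicator fun y => covDivB η U₀ A y + covLap η U₀ lam y +
          ((conjR (gaugeExp lam y)⁻¹ (covDivB η U₀ A y) - covDivB η U₀ A y) +
            (gAd (covLap η U₀ lam y) (lam y) - covLap η U₀ lam y) + ∑ μ, frakF3 η U₀ lam A y μ)) x =
          QT L (m + 1) (Λs (m + 1)) U₀ μ x) ∧
      Restr129 L (m + 1) (Λs (m + 1)) U₀ (u₁ * gaugeExp lam) := by
  subst hcs
  have hL1 : 1 ≤ L := le_trans (by norm_num) hL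
  have hd1 : 1 ≤ d := le_trans (by norm_num) hd2
  have hLr : (1 : ℝ) ≤ L := by exact_mod_cast hL1
  have hmK : m + 1 ≤ k := hmk
  have hsum : 0 < α₀ + α₁ := add_pos hα₀ hα₁
  have hcs0 : 0 ≤ 5 * (d : ℝ) * L * B₀ * (α₀ + α₁) := by positivity
  have hcspos : 0 < 5 * (d : ℝ) * L * B₀ * (α₀ + α₁) := by positivity
  have hα₄pos : 0 < α₄ := by rw [hα₄]; positivity
  -- `c⋆ ≤ L·c⋆ ≤ cB`, hence Prop. 3's remaining windows from the JOIN's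
  have hcsB : 5 * (d : ℝ) * L * B₀ * (α₀ + α₁) ≤ cB := (le_mul_of_one_le_left hcs0 hLr).trans hcBlo
  have hcB0 : 0 ≤ cB := hcs0.trans hcsB
  have hcA0 : 0 ≤ cA := (hcs0.trans (le_mul_of_one_le_left hcs0 hLr)).trans hcAlo
  have hcDA0 : 0 ≤ cDA := le_trans (by positivity) hcDAlo
  have hd0 : (1 : ℝ) ≤ d := by exact_mod_cast hd1
  have hcBsmall : (d : ℝ) * cB ≤ 1 / 8000 := by linarith only [hα₃']
  have hdcs : (d : ℝ) * (5 * (d : ℝ) * L * B₀ * (α₀ + α₁)) ≤ 1 / 8000 :=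
    (mul_le_mul_of_nonneg_left hcsB (by positivity)).trans hcBsmall
  have hcs8000 : 5 * (d : ℝ) * L * B₀ * (α₀ + α₁) ≤ 1 / 8000 := (le_mul_of_one_le_left hcs0 hd0).trans hdcs
  have h16 : 16 * (5 * (d : ℝ) * L * B₀ * (α₀ + α₁)) ≤ 1 := by linarith only [hcs8000]
  have h50 : 50 * d * (5 * (d : ℝ) * L * B₀ * (α₀ + α₁)) ≤ 1 := by linarith only [hdcs]
  have hd5 : 5 * (5 * (d : ℝ) * L * B₀ * (α₀ + α₁)) * ((d : ℝ) - 1) ≤ 4 := by nlinarith only [hdcs, hcs0]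
  have hc₃3 : 2 * (5 * (d : ℝ) * L * B₀ * (α₀ + α₁)) ≤ c3 d L := by linarith only [hc₃, hcsB]
  have hsmall3 : Real.exp (4 * (800 * ((d : ℝ) + 1) ^ 2 * ((d : ℝ) + 4)) * α₀) *
      (1 + 8 * (131072 * ((d : ℝ) + 1) ^ 2) * (5 * (d : ℝ) * L * B₀ * (α₀ + α₁))) ≤ 2 := by
    refine le_trans (mul_le_mul_of_nonneg_left ?_ (Real.exp_pos _).le) hsmall
    have h := mul_le_mul_of_nonneg_left hcsB (show (0 : ℝ) ≤ 8 * (131072 * ((d : ℝ) + 1) ^ 2) by positivity)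
    linarith only [h]
  have hαP2 : 2 * α₀ ≤ c2' d L := by linarith only [hα4, hα₀]
  -- the MASKED exponent `A′` of the datum (globally Hermitian, `= A` on the touched bonds)
  obtain ⟨A', hsa, hagree, hWA, hA0⟩ := exists_masked_datum hdat
  have hWA1 : ∀ j, j ≤ m → ∀ (y : Site d) (τ : Fin d), SideTouches (Ω j) y τ → U₁ y τ = cfgExp η A' y τ :=
    fun j hj y τ hs => (hWA j hj y τ hs).1
  have h41 : ∀ j, j ≤ m → ∀ (y : Site d) (τ : Fin d), SideTouches (Ω j) y τ →
      ‖A' y τ‖ ≤ (5 * (d : ℝ) * L * B₀ * (α₀ + α₁)) * ((L : ℝ) ^ j * η)⁻¹ := fun j hj y τ hs => (hWA j hj y τ hs).2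
  -- the JOIN's datum binders BY NAME (`B8Prop5SocketDatum` §7, §1, §5)
  have h33' := h33_of_inAk hL1 hα₀ h33 hmK htower
  have hP' := hP_of_datum hL1 hα₀ hΩ h34 hmK htower hu₁ hW hWA1
  have h69' : ∀ j, j ≤ m + 1 → ∀ y ∈ Λs (m + 1) j, ∀ (x : Site d) (κ : Fin d), InBox (tlo L y j) (thi L y j) x →
      InBox (tlo L y j) (thi L y j) (x + e κ) → ‖iEta η A' x κ‖ ≤ cB * ((L : ℝ) ^ j)⁻¹ :=
    fun j hj y hy x κ hx hxe =>
      (h69_of_datum hd2 hL1 hη hΩ htower hcs0 h41 j hj y hy x κ hx hxe).trans (mul_le_mul_of_nonneg_right hcBlo (by positivity))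
  have hA' : ∀ j, j ≤ m + 1 → ∀ x ∈ Ω j, ∀ μ : Fin d,
      wt L η j * ‖A' x μ‖ ≤ cA ∧ wt L η j * ‖conjR (U₀ (x - e μ) μ)⁻¹ (A' (x - e μ) μ)‖ ≤ cA := fun j hj x hx μ =>
    ⟨(hA_of_datum hd2 hL1 hη hΩ hU₀ hcs0 h41 j hj x hx μ).1.trans hcAlo, (hA_of_datum hd2 hL1 hη hΩ hU₀ hcs0 h41 j hj x hx μ).2.trans hcAlo⟩
  have hBu : ∀ (x : Site d) (κ : Fin d), expCfg (iEta η A') x κ ∈ unitaryUnits 𝔸 := expCfg_iEta_mem_unitaryUnits η hsa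
  have hAx' : InAx L (m + 1) (Λs (m + 1)) U₀ (mgauge U₀ u₁ (expCfg (iEta η A')) * U₀) :=
    inAx_mgauge_expCfg_of_datum hd2 hL1 hΩ htower hW hWA1 (hAx (m + 1) hmK)
  have h129' : Restr129 L (m + 1) (Λs (m + 1)) U₀ u₁ := restr129_succ_of_truncation hL1 hlt htop h129
  -- the source `D*A′`: (1.69)'s gradient member by Prop. 3 at level `m` (§3), then `|D*A′|₍₋₂₎ ≤ d·L²·c⋆ ≤ cDA` (§4); Hermitian
  have hgrad := grad_bound_of_datum hd2 hη hL k hU₀ hU' hα₀ hα₁ hcspos hB₀.le hα3 hα4 h16 hd5 hsmall3 hc₃3 hside h50 hC₂ h61 hsmall₁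
    Ω hΩ Λs Λb hbox hclass h33 h34 hAx h135 hm1 hmk.le SB9 hα₀9 hcs9 hu₁ hW h129 hLan hsa hWA hA0
  have hDA : Bd2 L η (m + 1) Ω (fun y => covDivB η U₀ A' y) cDA := fun j hj x hx =>
    (bd2_covDivB_of_grad hd2 hL1 hη hΩ hU₀ hcs0 hgrad j hj x hx).trans hcDAlo
  have hDAsa : ∀ j, j ≤ m + 1 → ∀ x ∈ Ω j, IsSelfAdjoint (covDivB η U₀ A' x) := fun j _ x _ => isSelfAdjoint_covDivB hU₀ hsa x
  -- the JOIN's bond classes `Eb j := {b ∣ SideTouches (Ω j) b}` (§6)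
  have hEbΩ : ∀ j, j ≤ m + 1 → ∀ x ∈ Ω j, ∀ μ : Fin d, (x, μ) ∈ {b : Site d × Fin d | SideTouches (Ω j) b.1 b.2} ∧
      (x - e μ, μ) ∈ {b : Site d × Fin d | SideTouches (Ω j) b.1 b.2} := fun j _ x hx μ => sideTouches_pair_of_mem hd2 hx μ
  have hEbT : ∀ j, j ≤ m + 1 → ∀ y ∈ Λs (m + 1) j, ∀ (x : Site d) (κ : Fin d), InBox (tlo L y j) (thi L y j) x →
      InBox (tlo L y j) (thi L y j) (x + e κ) → (x, κ) ∈ {b : Site d × Fin d | SideTouches (Ω j) b.1 b.2} :=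
    fun j hj y hy x κ hx _ => sideTouches_of_tower_bond hd2 htower hj hy x κ hx
  -- THE JOIN (n19-b's `hFP_kLevel_of_sectE_local'`, BY NAME) at `k := m + 1`, `Λs := Λs (m+1)`, `B := iηA′`, `αP := α₀`
  obtain ⟨lam, hlsa, hloff, h108, ⟨μ, hmul⟩, h129''⟩ := hFP_kLevel_of_sectE_local' (k := m + 1) (Λs := Λs (m + 1))
    (Eb := fun j => {b : Site d × Fin d | SideTouches (Ω j) b.1 b.2}) (u₁ := u₁) (A := A') hL hη hU₀ hEbΩ hEbT g Δ q qs Aw c g_left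
    g_right c_right hΔ hqs hq H' hα₀ hα3 hα4 hcB0 hα₄pos hB₀'H hB₂' h33' h69' hd1 hα₀ hα3 hαP2 hBu hP' hAx' h129' hH0 hH1 hH2 hHsupp
    hHequiv hQH hsmall hc₃ hsc hα₃' hs₁ hs₂ hs₃ hs₄ hs₅ hs₆ hs₇ hsm hprod8 hE_def hE₂_def lE_def lE₂_def hBG hBR hcA0 hcA' hcDA0 ha₁' hb₁'
    hθ hG hGsupp hGreal hRbd hRreal hDA hDAsa hA' hsa h103 h106
  refine ⟨lam, hlsa, hloff, fun j hj b hb => h108 j hj b hb, ⟨μ, fun x hx => ?_⟩, h129''⟩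
  -- transport the multiplier clause from `A′` back to `A`: the two agree on the bonds read on `Ω₀`
  have hind : ((Ω 0).indicator fun y => covDivB η U₀ A y + covLap η U₀ lam y +
        ((conjR (gaugeExp lam y)⁻¹ (covDivB η U₀ A y) - covDivB η U₀ A y) +
          (gAd (covLap η U₀ lam y) (lam y) - covLap η U₀ lam y) + ∑ μ, frakF3 η U₀ lam A y μ)) =
      ((Ω 0).indicator fun y => covDivB η U₀ A' y + covLap η U₀ lam y +
        ((conjR (gaugeExp lam y)⁻¹ (covDivB η U₀ A' y) - covDivB η U₀ A' y) +
          (gAd (covLap η U₀ lam y) (lam y) - covLap η U₀ lam y) + ∑ μ, frakF3 η U₀ lam A' y μ)) := by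
    refine Set.indicator_congr fun y hy => ?_
    have h₁ : ∀ ν : Fin d, A' y ν = A y ν := fun ν => hagree 0 (Nat.zero_le _) y ν (sideTouches_pair_of_mem hd2 hy ν).1
    have h₂ : ∀ ν : Fin d, A' (y - e ν) ν = A (y - e ν) ν := fun ν => hagree 0 (Nat.zero_le _) (y - e ν) ν (sideTouches_pair_of_mem hd2 hy ν).2
    have h₃ : ∀ ν : Fin d, frakF3 η U₀ lam A' y ν = frakF3 η U₀ lam A y ν := fun ν => frakF3_congr_at η U₀ lam (h₁ ν) (h₂ ν)
    simp only [covDivB_congr_at η U₀ h₁ h₂, h₃]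
  rw [hind]
  exact hmul x hx

end Body

/-! ## §2 THE SAME AT THE BASE DATUM `u₁ = 1`, `U₁ = U′` (p. 89): the ∃λ-body of `SockHFP₀` from the JOIN at one level -/

section Base

variable {𝔸 : Type*} [CStarAlgebra 𝔸] [Nontrivial 𝔸]

/-- **PROPOSITION 5'S FIXED POINT FOR THE BASE DATUM OF THEOREM 4 — the ∃λ-body of `B8LeafModelZdOfHFP.SockHFP₀` assembled from the JOIN at ONE
level.**  The base datum (p. 89: «for k = 0 … u₁ = 1, U₁ = U′»): `U′ = e^{iηA}`, `A` Hermitian, `|A| ≤ c⋆η⁻¹` on the sides of the plaquettes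
touching `Ω₀`; the JOIN runs at `k := 1` for `Λs 1` with `u₁ := 1` ((1.29) for `1` by `B8Thm4TruncationLocal.restr129_one`, `U^{1} = U`), the
source bound from the WEIGHT-FREE gradient bound `η²|∇A′| ≤ 2c⋆` (`B8Prop5SocketDatum.grad_bound_trivial` — no Proposition 3, no b9 socket at
level `0`), whence `cDA ≥ 2·d·L²·c⋆`; everything else as `sockHFP_body_of_join` with `m + 1 = 1` (towers of `Λs 1` inside `Ω_j`, the [4]
LETTERS at `(1, U₀)`, the JOIN's windows one-for-one).  CONCLUSION — VERBATIM the ∃λ-body of `SockHFP₀`.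
[cite: Balaban1985RegularSpaces, Prop. 5 (1.106)–(1.109) p.94, p.89 (the start of the induction), (1.66) p.88, (1.92)–(1.103) pp.92–93] -/
theorem sockHFP₀_body_of_join (hd2 : 2 ≤ d) {L : ℕ} (hL : 2 ≤ L) {η : ℝ} (hη : 0 < η) {k : ℕ} (hk : 1 ≤ k)
    -- the member's geometry
    {Ω : ℕ → Set (Site d)} (hΩ : ∀ j, Ω (j + 1) ⊆ Ω j) {Λs : ℕ → ℕ → Set (Site d)}
    (htower : ∀ j, j ≤ 1 → ∀ y ∈ Λs 1 j, ∀ x, InBox (tlo L y j) (thi L y j) x → x ∈ Ω j)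
    -- the socket's antecedents: constants, (1.33), (1.34)
    {α₀ α₁ B₀ B₀' cs α₄ : ℝ} (hα₀ : 0 < α₀) (hα₁ : 0 < α₁) (hB₀ : 0 < B₀) (hB₀' : 0 < B₀')
    (hcs : cs = 5 * (d : ℝ) * L * B₀ * (α₀ + α₁)) (hα₄ : α₄ = 8 * B₀' * (5 * (d : ℝ) * L * B₀) * (α₀ + α₁))
    {U₀ U' : Site d → Fin d → 𝔸ˣ} (hU₀ : ∀ x κ, U₀ x κ ∈ unitaryUnits 𝔸)
    (h33 : InAk L k η α₀ Ω U₀) (h34 : InAk L k η α₀ Ω (mulCfg U' U₀)) (hAx : ∀ m', m' ≤ k → InAx L m' (Λs m') U₀ (mulCfg U' U₀))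
    -- the base datum
    {A : Site d → Fin d → 𝔸}
    (hdat : ∀ j, j ≤ 0 → ∀ b ∈ {b : Site d × Fin d | SideTouches (Ω j) b.1 b.2},
      U' b.1 b.2 = cfgExp η A b.1 b.2 ∧ IsSelfAdjoint (A b.1 b.2) ∧ ‖A b.1 b.2‖ ≤ cs * ((L : ℝ) ^ j * η)⁻¹)
    -- the [4] LETTERS at `(1, U₀)`, displayed as the JOIN reads them
    (g Δ : (Site d → 𝔸) →ₗ[ℂ] (Site d → 𝔸)) (q : (Site d → 𝔸) →ₗ[ℂ] (ℕ → Site d → 𝔸)) (qs : (ℕ → Site d → 𝔸) →ₗ[ℂ] (Site d → 𝔸))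
    (Aw c : (ℕ → Site d → 𝔸) →ₗ[ℂ] (ℕ → Site d → 𝔸))
    (g_left : ∀ x, g (Δ x + qs (Aw (q x))) = x) (g_right : ∀ x, Δ (g x) + qs (Aw (q (g x))) = x)
    (c_right : ∀ φ, q (g (g (qs (c φ)))) = φ)
    (hΔ : ∀ (f : Site d → 𝔸), ∀ x ∈ Ω 0, Δ f x = covLap η U₀ ((Ω 0).indicator f) x)
    (hqs : ∀ (μ : ℕ → Site d → 𝔸), ∀ x ∈ Ω 0, qs μ x = QT L 1 (Λs 1) U₀ μ x)
    (hq : ∀ (f : Site d → 𝔸) (j : ℕ), j ≤ 1 → ∀ y ∈ Λs 1 j, q f j y = QprimeIter (zdBlocking d L) (bgT L U₀) j f y)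
    (H' : XSpace d 1 𝔸 →ₗ[ℂ] (Site d → 𝔸)) {B₀'H B₂' BG BR : ℝ} (hB₀'H : 0 < B₀'H) (hB₂' : 0 ≤ B₂') (hBG : 0 ≤ BG) (hBR : 0 ≤ BR)
    (hH0 : ∀ (X : XSpace d 1 𝔸) (x : Site d), ‖H' X x‖ ≤ B₀'H * ‖X‖)
    (hH1 : ∀ j, j ≤ 1 → ∀ (X : XSpace d 1 𝔸), ∀ p ∈ {b : Site d × Fin d | SideTouches (Ω j) b.1 b.2},
      wt L η j * ‖covDerivFwd η U₀ p.2 (H' X) p.1‖ ≤ B₀'H * ‖X‖)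
    (hH2 : ∀ X : XSpace d 1 𝔸, Bd2 L η 1 Ω (covLap η U₀ (H' X)) (B₂' * ‖X‖))
    (hHsupp : ∀ (X : XSpace d 1 𝔸) (x : Site d), x ∉ Ω 0 → H' X x = 0)
    (hHequiv : ∀ X Y : XSpace d 1 𝔸, (∀ p, Y p = -star (X p)) → ∀ x, H' Y x = -star (H' X x))
    (hQH : ∀ (Y : XSpace d 1 𝔸) (j : ℕ) (hj : j ≤ 1) (y : Site d), y ∈ Λs 1 j →
      QprimeIter (zdBlocking d L) (bgT L U₀) j (H' Y) y = Y (⟨j, Nat.lt_succ_of_le hj⟩, y))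
    (hG : ∀ (f : Site d → 𝔸) (r : ℝ), 0 ≤ r → Bd2 L η 1 Ω f r →
      (∀ x, ‖g f x‖ ≤ BG * r) ∧ ∀ j, j ≤ 1 → ∀ p ∈ {b : Site d × Fin d | SideTouches (Ω j) b.1 b.2},
        wt L η j * ‖covDerivFwd η U₀ p.2 (g f) p.1‖ ≤ BG * r)
    (hGsupp : ∀ (f : Site d → 𝔸) (x : Site d), x ∉ Ω 0 → g f x = 0)
    (hGreal : ∀ f : Site d → 𝔸, (∀ j, j ≤ 1 → ∀ x ∈ Ω j, IsSelfAdjoint (f x)) → ∀ x, IsSelfAdjoint (g f x))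
    (hRbd : ∀ (f : Site d → 𝔸) (r : ℝ), 0 ≤ r → Bd2 L η 1 Ω f r → Bd2 L η 1 Ω (f - g (qs (c (q (g f))))) (BR * r))
    (hRreal : ∀ f : Site d → 𝔸, (∀ j, j ≤ 1 → ∀ x ∈ Ω j, IsSelfAdjoint (f x)) →
      ∀ j, j ≤ 1 → ∀ x ∈ Ω j, IsSelfAdjoint ((f - g (qs (c (q (g f))))) x))
    -- the JOIN's scalar windows, one-for-one (`αP := α₀`, `α₄ := 8B₀′c⋆`; `cB cA cDA` free above their datum values, `cDA ≥ 2dL²c⋆` here)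
    {cB cA cDA : ℝ} (hcBlo : L * cs ≤ cB) (hcAlo : L * cs ≤ cA) (hcDAlo : 2 * (d : ℝ) * (L : ℝ) ^ 2 * cs ≤ cDA)
    (hα3 : C0 d * α₀ ≤ 1 / 3) (hα4 : 4 * α₀ ≤ c2' d L)
    (hsmall : Real.exp (4 * (800 * ((d : ℝ) + 1) ^ 2 * ((d : ℝ) + 4)) * α₀) * (1 + 8 * (131072 * ((d : ℝ) + 1) ^ 2) * cB) ≤ 2)
    (hc₃ : 2 * cB ≤ c3 d L) (hsc : 2048 * (d : ℝ) * cB ≤ 1) (hα₃' : 40 * d * cB ≤ 1 / 200)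
    (hs₁ : 200 * C6 d * (2 * α₄) ≤ 1) (hs₂ : 12000 * ((d : ℝ) + 1) * L * (2 * α₄) ≤ 1)
    (hs₃ : C4G d L * (α₀ + 40 * d * cB + 4 * (2 * α₄)) ≤ 1)
    (hs₄ : 1024 * ((d : ℝ) + 1) * ((d : ℝ) + 4) * L ^ 2 * α₀ ≤ 1) (hs₅ : 32 * ((d : ℝ) + 1) ^ 2 * C6 d * L ^ 2 * α₀ ≤ 1)
    (hs₆ : 16 * d * C5' d * C6 d * (L : ℝ) ^ 2 * α₀ ≤ 1) (hs₇ : 8 * d * C6 d * L * α₀ ≤ 1)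
    (hsm : 40 * d * cB + α₄ ≤ 1 / (4 * B₀'H * (2 * C2p d))) (hprod8 : 2 * C6 d * (40 * d * cB + 4 * α₄) ≤ 1 / 8)
    {hE hE₂ lE lE₂ : ℝ} (hE_def : hE = B₀'H * (C2p d * (40 * d * cB + α₄) * α₄)) (hE₂_def : hE₂ = B₂' * (C2p d * (40 * d * cB + α₄) * α₄))
    (lE_def : lE = B₀'H * (4 * C2p d * (40 * d * cB + 2 * α₄))) (lE₂_def : lE₂ = B₂' * (4 * C2p d * (40 * d * cB + 2 * α₄)))
    (hcA' : cA ≤ 1 / 13) (ha₁' : α₄ / 4 + hE ≤ 1 / 24) (hb₁' : α₄ / 4 + hE ≤ 1 / 140) (hθ : 10 * (α₄ / 4 + hE) * BR ≤ 1 / 2)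
    (h103 : BG * Mc d BR (α₄ / 4 + hE) cA hE₂ cDA ≤ α₄ / 4)
    (h106 : BG * Kc d BR (α₄ / 4 + hE) cA hE₂ cDA lE₂ (1 + lE) (1 + lE) ≤ 1 / 2) :
    ∃ lam : Site d → 𝔸, (∀ x, IsSelfAdjoint (lam x)) ∧ (∀ x, x ∉ Ω 0 → lam x = 0) ∧
      (∀ j, j ≤ 1 → ∀ b ∈ {b : Site d × Fin d | SideTouches (Ω j) b.1 b.2},
        ‖lam b.1‖ ≤ α₄ ∧ ((L : ℝ) ^ j * η) * ‖covDerivFwd η U₀ b.2 lam b.1‖ ≤ α₄) ∧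
      (∃ μ : ℕ → Site d → 𝔸, ∀ x ∈ Ω 0,
        covLap η U₀ ((Ω 0).indicator fun y => covDivB η U₀ A y + covLap η U₀ lam y +
          ((conjR (gaugeExp lam y)⁻¹ (covDivB η U₀ A y) - covDivB η U₀ A y) +
            (gAd (covLap η U₀ lam y) (lam y) - covLap η U₀ lam y) + ∑ μ, frakF3 η U₀ lam A y μ)) x =
          QT L 1 (Λs 1) U₀ μ x) ∧
      Restr129 L 1 (Λs 1) U₀ ((1 : Site d → 𝔸ˣ) * gaugeExp lam) := by
  subst hcs
  have hL1 : 1 ≤ L := le_trans (by norm_num) hL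
  have hd1 : 1 ≤ d := le_trans (by norm_num) hd2
  have hLr : (1 : ℝ) ≤ L := by exact_mod_cast hL1
  have hk1 : 0 + 1 ≤ k := hk
  have hsum : 0 < α₀ + α₁ := add_pos hα₀ hα₁
  have hcs0 : 0 ≤ 5 * (d : ℝ) * L * B₀ * (α₀ + α₁) := by positivity
  have hα₄pos : 0 < α₄ := by rw [hα₄]; positivity
  have hcB0 : 0 ≤ cB := (hcs0.trans (le_mul_of_one_le_left hcs0 hLr)).trans hcBlo
  have hcA0 : 0 ≤ cA := (hcs0.trans (le_mul_of_one_le_left hcs0 hLr)).trans hcAlo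
  have hcDA0 : 0 ≤ cDA := le_trans (by positivity) hcDAlo
  have hαP2 : 2 * α₀ ≤ c2' d L := by linarith only [hα4, hα₀]
  -- the MASKED exponent `A′` of the base datum (globally Hermitian, `= A` on the sides touching `Ω₀`)
  obtain ⟨A', hsa, hagree, hWA, hA0⟩ := exists_masked_datum hdat
  have hWA1 : ∀ j, j ≤ 0 → ∀ (y : Site d) (τ : Fin d), SideTouches (Ω j) y τ → U' y τ = cfgExp η A' y τ :=
    fun j hj y τ hs => (hWA j hj y τ hs).1
  have h41 : ∀ j, j ≤ 0 → ∀ (y : Site d) (τ : Fin d), SideTouches (Ω j) y τ →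
      ‖A' y τ‖ ≤ (5 * (d : ℝ) * L * B₀ * (α₀ + α₁)) * ((L : ℝ) ^ j * η)⁻¹ := fun j hj y τ hs => (hWA j hj y τ hs).2
  -- the base datum `u₁ = 1`, `U₁ = U′`
  have hone : mgauge U₀ (1 : Site d → 𝔸ˣ) U' = U' := mgauge_one_eq U₀ U'
  have hu1 : ∀ x, (1 : Site d → 𝔸ˣ) x ∈ unitaryUnits 𝔸 := fun _ => (unitaryUnits 𝔸).one_mem
  -- the JOIN's datum binders BY NAME (`B8Prop5SocketDatum` §7, §1; `restr129_one`)
  have h33' := h33_of_inAk (m := 0) hL1 hα₀ h33 hk1 htower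
  have hP' := hP_of_datum (m := 0) hL1 hα₀ hΩ h34 hk1 htower hu1 hone hWA1
  have h69' : ∀ j, j ≤ 1 → ∀ y ∈ Λs 1 j, ∀ (x : Site d) (κ : Fin d), InBox (tlo L y j) (thi L y j) x →
      InBox (tlo L y j) (thi L y j) (x + e κ) → ‖iEta η A' x κ‖ ≤ cB * ((L : ℝ) ^ j)⁻¹ :=
    fun j hj y hy x κ hx hxe =>
      (h69_of_datum (m := 0) hd2 hL1 hη hΩ htower hcs0 h41 j hj y hy x κ hx hxe).trans
        (mul_le_mul_of_nonneg_right hcBlo (by positivity))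
  have hA' : ∀ j, j ≤ 1 → ∀ x ∈ Ω j, ∀ μ : Fin d,
      wt L η j * ‖A' x μ‖ ≤ cA ∧ wt L η j * ‖conjR (U₀ (x - e μ) μ)⁻¹ (A' (x - e μ) μ)‖ ≤ cA := fun j hj x hx μ =>
    ⟨(hA_of_datum (m := 0) hd2 hL1 hη hΩ hU₀ hcs0 h41 j hj x hx μ).1.trans hcAlo,
      (hA_of_datum (m := 0) hd2 hL1 hη hΩ hU₀ hcs0 h41 j hj x hx μ).2.trans hcAlo⟩
  have hBu : ∀ (x : Site d) (κ : Fin d), expCfg (iEta η A') x κ ∈ unitaryUnits 𝔸 := expCfg_iEta_mem_unitaryUnits η hsa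
  have hAx' : InAx L 1 (Λs 1) U₀ (mgauge U₀ 1 (expCfg (iEta η A')) * U₀) :=
    inAx_mgauge_expCfg_of_datum (m := 0) hd2 hL1 hΩ htower hone hWA1 (hAx 1 hk)
  have h129' : Restr129 L 1 (Λs 1) U₀ (1 : Site d → 𝔸ˣ) := B8Thm4TruncationLocal.restr129_one L 1 (Λs 1) U₀
  -- the source `D*A′` from the weight-free gradient bound `η²|∇A′| ≤ 2c⋆`: `|D*A′|₍₋₂₎ ≤ d·L²·2c⋆ ≤ cDA` at one level; Hermitian
  have hgrad : ∀ j, j ≤ 0 → ∀ (y : Site d) (κ τ : Fin d), SideTouches (Ω j) y τ →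
      ((L : ℝ) ^ j * η) ^ 2 * ‖covDerivFwd η U₀ κ (fun z => A' z τ) y‖ ≤ 2 * (5 * (d : ℝ) * L * B₀ * (α₀ + α₁)) := by
    intro j hj y κ τ _
    obtain rfl : j = 0 := Nat.le_zero.mp hj
    rw [pow_zero, one_mul]
    exact grad_bound_trivial hη hL1 hU₀ hcs0 h41 hA0 y κ τ
  have hcDAlo' : (d : ℝ) * (L : ℝ) ^ 2 * (2 * (5 * (d : ℝ) * L * B₀ * (α₀ + α₁))) ≤ cDA := by
    have e : (d : ℝ) * (L : ℝ) ^ 2 * (2 * (5 * (d : ℝ) * L * B₀ * (α₀ + α₁))) = 2 * (d : ℝ) * (L : ℝ) ^ 2 * (5 * (d : ℝ) * L * B₀ * (α₀ + α₁)) := by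
      ring
    rw [e]; exact hcDAlo
  have hDA : Bd2 L η 1 Ω (fun y => covDivB η U₀ A' y) cDA := fun j hj x hx =>
    (bd2_covDivB_of_grad (m := 0) hd2 hL1 hη hΩ hU₀ (by positivity) hgrad j hj x hx).trans hcDAlo'
  have hDAsa : ∀ j, j ≤ 1 → ∀ x ∈ Ω j, IsSelfAdjoint (covDivB η U₀ A' x) := fun j _ x _ => isSelfAdjoint_covDivB hU₀ hsa x
  -- the JOIN's bond classes `Eb j := {b ∣ SideTouches (Ω j) b}` (§6)
  have hEbΩ : ∀ j, j ≤ 1 → ∀ x ∈ Ω j, ∀ μ : Fin d, (x, μ) ∈ {b : Site d × Fin d | SideTouches (Ω j) b.1 b.2} ∧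
      (x - e μ, μ) ∈ {b : Site d × Fin d | SideTouches (Ω j) b.1 b.2} := fun j _ x hx μ => sideTouches_pair_of_mem hd2 hx μ
  have hEbT : ∀ j, j ≤ 1 → ∀ y ∈ Λs 1 j, ∀ (x : Site d) (κ : Fin d), InBox (tlo L y j) (thi L y j) x →
      InBox (tlo L y j) (thi L y j) (x + e κ) → (x, κ) ∈ {b : Site d × Fin d | SideTouches (Ω j) b.1 b.2} :=
    fun j hj y hy x κ hx _ => sideTouches_of_tower_bond hd2 htower hj hy x κ hx
  -- THE JOIN (n19-b's `hFP_kLevel_of_sectE_local'`, BY NAME) at `k := 1`, `Λs := Λs 1`, `u₁ := 1`, `B := iηA′`, `αP := α₀`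
  obtain ⟨lam, hlsa, hloff, h108, ⟨μ, hmul⟩, h129''⟩ := hFP_kLevel_of_sectE_local' (k := 1) (Λs := Λs 1)
    (Eb := fun j => {b : Site d × Fin d | SideTouches (Ω j) b.1 b.2}) (u₁ := (1 : Site d → 𝔸ˣ)) (A := A') hL hη hU₀ hEbΩ hEbT g Δ q qs
    Aw c g_left g_right c_right hΔ hqs hq H' hα₀ hα3 hα4 hcB0 hα₄pos hB₀'H hB₂' h33' h69' hd1 hα₀ hα3 hαP2 hBu hP' hAx' h129' hH0 hH1
    hH2 hHsupp hHequiv hQH hsmall hc₃ hsc hα₃' hs₁ hs₂ hs₃ hs₄ hs₅ hs₆ hs₇ hsm hprod8 hE_def hE₂_def lE_def lE₂_def hBG hBR hcA0 hcA' hcDA0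
    ha₁' hb₁' hθ hG hGsupp hGreal hRbd hRreal hDA hDAsa hA' hsa h103 h106
  refine ⟨lam, hlsa, hloff, fun j hj b hb => h108 j hj b hb, ⟨μ, fun x hx => ?_⟩, h129''⟩
  -- transport the multiplier clause from `A′` back to `A`: the two agree on the bonds read on `Ω₀`
  have hind : ((Ω 0).indicator fun y => covDivB η U₀ A y + covLap η U₀ lam y +
        ((conjR (gaugeExp lam y)⁻¹ (covDivB η U₀ A y) - covDivB η U₀ A y) +
          (gAd (covLap η U₀ lam y) (lam y) - covLap η U₀ lam y) + ∑ μ, frakF3 η U₀ lam A y μ)) =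
      ((Ω 0).indicator fun y => covDivB η U₀ A' y + covLap η U₀ lam y +
        ((conjR (gaugeExp lam y)⁻¹ (covDivB η U₀ A' y) - covDivB η U₀ A' y) +
          (gAd (covLap η U₀ lam y) (lam y) - covLap η U₀ lam y) + ∑ μ, frakF3 η U₀ lam A' y μ)) := by
    refine Set.indicator_congr fun y hy => ?_
    have h₁ : ∀ ν : Fin d, A' y ν = A y ν := fun ν => hagree 0 le_rfl y ν (sideTouches_pair_of_mem hd2 hy ν).1
    have h₂ : ∀ ν : Fin d, A' (y - e ν) ν = A (y - e ν) ν := fun ν => hagree 0 le_rfl (y - e ν) ν (sideTouches_pair_of_mem hd2 hy ν).2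
    have h₃ : ∀ ν : Fin d, frakF3 η U₀ lam A' y ν = frakF3 η U₀ lam A y ν := fun ν => frakF3_congr_at η U₀ lam (h₁ ν) (h₂ ν)
    simp only [covDivB_congr_at η U₀ h₁ h₂, h₃]
  rw [hind]
  exact hmul x hx

end Base

#print axioms isSelfAdjoint_covDivB
#print axioms inAx_mgauge_expCfg_of_datum
#print axioms sockHFP_body_of_join
#print axioms sockHFP₀_body_of_join

end Literature.MathematicalPhysics.QuantumFieldTheory.Balaban1983to89.B8SockHFPAssembly

end
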